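/-
Copyright (c) 2026 the pub-hodgecm-mathlib formalisation cell (harness21).  Prover seat hodgecm-mathlib-F0P3a-p05 (g17): road «S3-ram» (LEAD F0P3a-plan (g12); owner∕table
F0P3a-p06 (g15); architect A-p16 (g31)), the (a2) JUNCTION (J★) of F0P3a-p01 (g17), J-PACK v2 **ROW-1C «ONE CLASS PER RANK-ONE VERTEX»** (socket `row_oneClass` of
`JunctionSockets.skeleton.v1`, 157608bd); 2026-09-02.
-/
import Literature.NumberTheory.Automorphic.UnitaryLatticeTreeRankOneVertexShapeRamified        -- ★ K p847456 (F0P2-p01 (g15)): `v_coe_sub_one_apply_sub_rev_le_of_odd` (symmetry at odd depth); brings ★ I p847392 `forall_v_coe_sub_one_le_succ_of_even_of_sq_le` (parity), ★ p847340 `map_toLin'_latt_le_scaleLattice_iff`, `inv_mul_sq_mul_eq_sq`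
import Literature.NumberTheory.Automorphic.UnitaryLatticeTreeRootStarPredicateCountRamified    -- ★ G3⁗ p847467 (F0P2-p06 (g13)): `exists_integer_eq_test_and_residue_eq`, `exists_unit_v_sub_mul_sq_lt_one_iff_residue`; brings ★ G3′ `dotProduct_antidiagonal_three_mulVec_eq_sum`, ★ `residue_eq_zero_iff_v_lt_one`, `residue_eq_of_v_sub_lt_one`
import Literature.NumberTheory.Automorphic.UnitaryLatticeTreeFixedGrandchildrenCountRamified   -- ★ G3⁺ p847297 (F0P2-p06 (g12)): `forall_v_conj_sub_one_le_iff_map_sub_one_le_scaleLattice`; brings ★ `exists_latticeGraphIso_root_eq_of_v_two` (transitivity), ★ `coe_inv_mul_mul_sub_one`, `mem_mapGL_iff`, `pairing_mulVec_mulVec_of_mem_unitary`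
import Mathlib.NumberTheory.LegendreSymbol.QuadraticChar.Basic                                   -- `quadraticChar` (non-square × non-square is a square in a finite field)
import HarnessLib

/-!
# The lattice graph of a hermitian space — ONE CLASS PER RANK-ONE VERTEX at a tamely ramified place: at a fixed self-dual vertex of exact depth `d` and rank one the unit
# values `ϖ^{−d}·B₀(y, (γ − 1)y)` form ONE square class (Rogawski 1990 §4.9; Kottwitz 1986 §3; Bruhat–Tits 1972 §10; Tits 1979 §3.5)

Topic `NumberTheory/Automorphic`; namespace `Literature.NumberTheory.Automorphic.UnitaryLatticeTree`.  THEOREMS ONLY (no definition, no instance, no notation, no named fact,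
no `sorry`); kernel lane `--supports stmt-HodgeConjecture-24833`.  Cell `pub/hodgecm-mathlib` (D-0151), crux H413; road «S3-ram» (Literature seeding, count-neutral), organ
A′e of the P-1-ram skeleton (architect A-p16 (g31)), the JUNCTION (J★) `stub_signedStrataCount_typeOne_ram` of F0P3a-p01 (g16∕g17): J-PACK v2 (`F0/P3a/F0P3a-p01/g17/junction/
JPACK-v2.F0P3ap01g17.md` 03ef5f1f) runs the (a2) tree-induction engine ★ p847302 in the `J₀`-model and deals its local laws as ROWS in TOKEN currency (`LEV`, `LEV₂`, `LEV₃`, `CLS`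
at a vertex `w`); **ROW-1C** is the label fact behind the engine's `cl w ∈ {±1}`: at a rank-one vertex the class token `CLS[w] d c` holds for EXACTLY ONE of `c`, `c·ε` (`ε` a
residual non-square) — the depth-`d` residual form is `λ·ℓ²`, one square class.  DATUM as in ★ G3′∕G3⁗∕I∕K: `σ` a valuation-preserving involution with `σϖ = −ϖ`, residually
trivial (`|σx − x| < 1` on `𝒪`), `|2| = 1`, finite residue field `𝓀`.  The head `class_xor_class_mul_of_fixed_selfDual_rankOne` has the TEXT of the junction socket
`row_oneClass` (`F0/P3a/F0P3a-p01/g17/junction/JunctionSockets.skeleton.v1.F0P3ap01g17.lean` :129, sha16 157608bd) binder for binder (the socket's `hγ0 hfix hnil` are carried,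
unused).

THE MATHEMATICS ([Rogawski1990] §4.9 p. 55, the rank-one labels `1□_{±}`; [Kottwitz1986] §3; [Tits1979] §3.5).  Let `w = u·L₀` (`u ∈ U(σ, J₀)`: transitivity ★
`exists_latticeGraphIso_root_eq_of_v_two`), `γ′ = u⁻¹γu`, `Y = γ′ − 1`; the tokens at `w` read `|Y_{ij}| ≤ |ϖ|^d` (`LEV (ϖ^d)`), NOT all `≤ |ϖ|^{d+1}` (`¬LEV (ϖ^{d+1})`),
`|(Y²)_{ij}| ≤ |ϖ|^{2d+1}` (`LEV₂ (ϖ^{2d+1})`) (★ `map_toLin'_latt_le_scaleLattice_iff`), and `CLS[w] d t ⟺ ∃ x ∈ 𝒪³, |a| = 1: |ϖ^{−d}B₀(x, Yx) − t·a²| < 1` (`B₀(uy, uz) =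
B₀(y, z)`).  PARITY: `d` is odd — at even `d` rank `≤ 1` forces depth `d+1` (★ p847392).  RESIDUALLY, `Ȳ := red(ϖ^{−d}Y) ∈ M₃(𝓀)` is `J₀`-SYMMETRIC (`Ȳ_{ij} = Ȳ_{rev j, rev i}`, ★
`v_coe_sub_one_apply_sub_rev_le_of_odd`), `Ȳ² = 0` (from `LEV₂`) and `Ȳ ≠ 0` (exact depth), and `CLS[w] d t ⟺ ∃ x̄, ā ≠ 0: ᵗx̄(J̄₀Ȳ)x̄ = t̄·ā²` (★ G3⁗ dictionary).  §1 (any field):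
the columns of such a `Ȳ` are pairwise ISOTROPIC AND ORTHOGONAL for the split form `u₀w₂ + u₁w₁ + u₂w₀` (`Σ_i Ȳ_{ij}Ȳ_{rev i,k} = (Ȳ²)_{rev j,k} = 0`), two such vectors are
PROPORTIONAL (the square of each `2×2` minor is a combination of the three relations), so all minors of `Ȳ` vanish, some anti-diagonal entry `s₀ = Ȳ_{rev i₀, i₀}` is non-zero, and
`s₀ · ᵗx̄(J̄₀Ȳ)x̄ = ℓ(x̄)²` with `ℓ(x̄) = Σ_b Ȳ_{rev i₀, b} x̄_b`: a non-zero class `t·(𝓀ˣ)²` is taken iff `s₀·t` is a square.  Over the FINITE field `𝓀` (odd characteristic is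
automatic from `ε` being a non-square) exactly one of `s₀c`, `s₀cε` is a square (`quadraticChar` is multiplicative), whence the head.
HONEST LABEL: HC_CM is proved only modulo the 2 remaining named inputs (hLiu418 24832, h413 24833) until rung 0 closes; nothing printed is asserted here (elementary algebra over a
valuation ring and a finite field); «S3-ram» has no books consequence.

* §1 (residual algebra over a field) `apply_mul_apply_eq_of_isotropic_of_orthogonal`, `col_isotropic_orthogonal_of_symm_of_mul_self_eq_zero`,
  `apply_mul_apply_eq_of_symm_of_mul_self_eq_zero` (minors vanish), `exists_apply_rev_ne_zero_of_symm_of_mul_self_eq_zero`, **`apply_rev_mul_dotProduct_eq_sq`** (`s₀·q = ℓ²`),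
  `single_dotProduct_antidiagonal_mul_mulVec_single`, **`exists_forall_represents_iff_of_symm_of_mul_self_eq_zero`** (one square class),
  **`represents_xor_represents_mul_of_symm_of_mul_self_eq_zero`** (the `c ∕ c·ε` dichotomy over a finite field).
* §2 (valuation → residue) `exists_integer_matrix_eq_inv_pow_mul`, `map_residue_mul_self_eq_zero_of_sq_le`, `map_residue_apply_eq_rev_of_sub_le`,
  `map_residue_ne_zero_of_not_forall_le_succ`, **`exists_mem_stdLattice_depthClass_iff_residue`** (the `CLS` token at `L₀` read residually), `exists_mem_mapGL_stdLattice_depthClass_iff`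
  (the `CLS` token at `u·L₀` is the token at `L₀` for `u⁻¹γu`).
* §3 **`class_xor_class_mul_stdLattice_of_rankOne`** (matrix form at `L₀`), **`class_xor_class_mul_of_fixed_selfDual_rankOne`** (= socket `row_oneClass`, vertex form).

## References
* [Rogawski1990] J. D. Rogawski, *Automorphic Representations of Unitary Groups in Three Variables*, Ann. of Math. Stud. 123 (1990), §4.9 pp. 54–55 (the labels of `γ`-fixed
  lattices; the two rank-one classes).
* [Kottwitz1986] R. E. Kottwitz, *Base change for unit elements of Hecke algebras*, Compositio Math. 60 (1986), §3 (counting fixed lattices by residual data).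
* [BruhatTits1972] F. Bruhat, J. Tits, *Groupes réductifs sur un corps local I*, Publ. Math. IHÉS 41 (1972), §10 (vertex stabilisers, congruence filtration, residual forms).
* [Tits1979] J. Tits, *Reductive groups over local fields*, PSPM 33.1 (1979), §3.5 (filtration quotients of a parahoric of ramified `U(3)`).
* [Serre1980Trees] J.-P. Serre, *Trees* (1980), Ch. II §1.1 (lattices, levels, the residual reading).
-/

set_option autoImplicit false

noncomputable section

open scoped Valued WithZero Matrix MatrixGroups

namespace Literature.NumberTheory.Automorphic.UnitaryLatticeTree

open Literature.NumberTheory.Automorphic Literature.NumberTheory.Automorphic.HermitianLattice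

/-! ## §1 Residual algebra over a field: a `J₀`-symmetric matrix of square zero has rank `≤ 1`, so its quadratic form takes ONE square class of non-zero values -/

section Residual

variable {F : Type*} [Field F]

/-- **Two isotropic, mutually orthogonal vectors of the split ternary form `u₀w₂ + u₁w₁ + u₂w₀` are proportional** (all `2 × 2` minors vanish: the square of each minor is a
combination of the three relations). [cite: BruhatTits1972, §10] -/
theorem apply_mul_apply_eq_of_isotropic_of_orthogonal (u w : Fin 3 → F)
    (hu : u 0 * u 2 + u 1 * u 1 + u 2 * u 0 = 0) (hw : w 0 * w 2 + w 1 * w 1 + w 2 * w 0 = 0) (huw : u 0 * w 2 + u 1 * w 1 + u 2 * w 0 = 0) (i l : Fin 3) :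
    u i * w l = u l * w i := by
  have m01 : u 0 * w 1 = u 1 * w 0 := by
    have h : (u 0 * w 1 - u 1 * w 0) ^ 2 = 0 := by
      linear_combination (w 0 ^ 2) * hu + (u 0 ^ 2) * hw - (2 * u 0 * w 0) * huw
    exact sub_eq_zero.1 (pow_eq_zero_iff two_ne_zero |>.1 h)
  have m12 : u 1 * w 2 = u 2 * w 1 := by
    have h : (u 1 * w 2 - u 2 * w 1) ^ 2 = 0 := by
      linear_combination (w 2 ^ 2) * hu + (u 2 ^ 2) * hw - (2 * u 2 * w 2) * huw
    exact sub_eq_zero.1 (pow_eq_zero_iff two_ne_zero |>.1 h)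
  have m02 : u 0 * w 2 = u 2 * w 0 := by
    have h : (u 0 * w 2 - u 2 * w 0) ^ 2 = 0 := by
      linear_combination (u 0 * w 2 + u 2 * w 0 - u 1 * w 1) * huw + (w 1 ^ 2) * hu - (2 * u 0 * u 2) * hw
    exact sub_eq_zero.1 (pow_eq_zero_iff two_ne_zero |>.1 h)
  fin_cases i <;> fin_cases l
  · rfl
  · exact m01
  · exact m02
  · exact m01.symm
  · rfl
  · exact m12
  · exact m02.symm
  · exact m12.symm
  · rfl

/-- **The columns of a `J₀`-symmetric matrix of square zero are pairwise isotropic and orthogonal** for the split form (`Σ_i Ȳ_{ij} Ȳ_{rev i, k} = (Ȳ²)_{rev j, k} = 0`).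
[cite: BruhatTits1972, §10] [cite: Tits1979, §3.5] -/
theorem col_isotropic_orthogonal_of_symm_of_mul_self_eq_zero (Y : Matrix (Fin 3) (Fin 3) F) (hsymm : ∀ i j, Y i j = Y j.rev i.rev) (hsq : Y * Y = 0)
    (j k : Fin 3) : Y 0 j * Y 2 k + Y 1 j * Y 1 k + Y 2 j * Y 0 k = 0 := by
  have h := congr_fun (congr_fun hsq j.rev) k
  rw [Matrix.mul_apply, Fin.sum_univ_three, Matrix.zero_apply] at h
  have hr0 : (0 : Fin 3).rev = 2 := rfl
  have hr1 : (1 : Fin 3).rev = 1 := rfl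
  have hr2 : (2 : Fin 3).rev = 0 := rfl
  have e0 : Y 0 j = Y j.rev 2 := by rw [hsymm 0 j, hr0]
  have e1 : Y 1 j = Y j.rev 1 := by rw [hsymm 1 j, hr1]
  have e2 : Y 2 j = Y j.rev 0 := by rw [hsymm 2 j, hr2]
  rw [e0, e1, e2]
  linear_combination h

/-- **All `2 × 2` minors of a `J₀`-symmetric matrix of square zero vanish** (rank `≤ 1`). [cite: BruhatTits1972, §10] [cite: Kottwitz1986, §3] -/
theorem apply_mul_apply_eq_of_symm_of_mul_self_eq_zero (Y : Matrix (Fin 3) (Fin 3) F) (hsymm : ∀ i j, Y i j = Y j.rev i.rev) (hsq : Y * Y = 0)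
    (i l j k : Fin 3) : Y i j * Y l k = Y l j * Y i k :=
  apply_mul_apply_eq_of_isotropic_of_orthogonal (fun a => Y a j) (fun a => Y a k)
    (col_isotropic_orthogonal_of_symm_of_mul_self_eq_zero Y hsymm hsq j j) (col_isotropic_orthogonal_of_symm_of_mul_self_eq_zero Y hsymm hsq k k)
    (col_isotropic_orthogonal_of_symm_of_mul_self_eq_zero Y hsymm hsq j k) i l

/-- **A non-zero `J₀`-symmetric matrix of square zero has a non-zero ANTI-DIAGONAL entry `Ȳ_{rev i, i}`** (a non-zero diagonal entry of the symmetric `J̄₀Ȳ`): otherwise every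
entry squares to a product of two such (minors + symmetry) and vanishes. [cite: BruhatTits1972, §10] [cite: Kottwitz1986, §3] -/
theorem exists_apply_rev_ne_zero_of_symm_of_mul_self_eq_zero (Y : Matrix (Fin 3) (Fin 3) F) (hsymm : ∀ i j, Y i j = Y j.rev i.rev) (hsq : Y * Y = 0)
    (hne : Y ≠ 0) : ∃ i₀ : Fin 3, Y i₀.rev i₀ ≠ 0 := by
  by_contra hall
  push Not at hall
  apply hne
  ext a b
  have hmin := apply_mul_apply_eq_of_symm_of_mul_self_eq_zero Y hsymm hsq a b.rev b a.rev
  -- `Y a b · Y (rev b) (rev a) = Y (rev b) b · Y a (rev a) = 0`, and `Y (rev b) (rev a) = Y a b`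
  rw [hall b, zero_mul, ← hsymm a b, ← pow_two] at hmin
  rw [Matrix.zero_apply]
  exact pow_eq_zero_iff two_ne_zero |>.1 hmin

/-- **THE QUADRATIC FORM OF A RANK-ONE `J₀`-SYMMETRIC MATRIX IS A SCALED SQUARE OF A LINEAR FORM**: with `s₀ = Ȳ_{rev i₀, i₀}` and `ℓ(x) = Σ_b Ȳ_{rev i₀, b} x_b`,
`s₀ · ᵗx̄ (J̄₀Ȳ) x̄ = ℓ(x̄)²`. [cite: BruhatTits1972, §10] [cite: Kottwitz1986, §3] -/
theorem apply_rev_mul_dotProduct_eq_sq (Y : Matrix (Fin 3) (Fin 3) F) (hsymm : ∀ i j, Y i j = Y j.rev i.rev) (hsq : Y * Y = 0) (i₀ : Fin 3) (x : Fin 3 → F) :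
    Y i₀.rev i₀ * (x ⬝ᵥ ((((StdForm.antidiagonal 3).over F) * Y) *ᵥ x)) = (∑ b, Y i₀.rev b * x b) ^ 2 := by
  -- the rank-one relations `Y (rev a) b · s₀ = ℓ_a · ℓ_b`
  have hrel : ∀ a b : Fin 3, Y a.rev b * Y i₀.rev i₀ = Y i₀.rev a * Y i₀.rev b := by
    intro a b
    rw [apply_mul_apply_eq_of_symm_of_mul_self_eq_zero Y hsymm hsq a.rev i₀.rev b i₀, hsymm a.rev i₀, Fin.rev_rev, mul_comm]
  rw [← Matrix.mulVec_mulVec, dotProduct_antidiagonal_three_mulVec_eq_sum]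
  simp only [Matrix.mulVec, dotProduct, Fin.sum_univ_three]
  have hr0 : (0 : Fin 3).rev = 2 := rfl
  have hr1 : (1 : Fin 3).rev = 1 := rfl
  have hr2 : (2 : Fin 3).rev = 0 := rfl
  have h00 := hrel 0 0; have h01 := hrel 0 1; have h02 := hrel 0 2
  have h10 := hrel 1 0; have h11 := hrel 1 1; have h12 := hrel 1 2
  have h20 := hrel 2 0; have h21 := hrel 2 1; have h22 := hrel 2 2
  rw [hr0] at h00 h01 h02
  rw [hr1] at h10 h11 h12
  rw [hr2] at h20 h21 h22
  rw [hr0, hr1, hr2]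
  linear_combination (x 0 * x 0) * h00 + (x 0 * x 1) * h01 + (x 0 * x 2) * h02 + (x 1 * x 0) * h10 + (x 1 * x 1) * h11 + (x 1 * x 2) * h12 +
    (x 2 * x 0) * h20 + (x 2 * x 1) * h21 + (x 2 * x 2) * h22

/-- The value at the basis vector `e_{i₀}` is the anti-diagonal entry `Ȳ_{rev i₀, i₀}`. [cite: BruhatTits1972, §10] -/
theorem single_dotProduct_antidiagonal_mul_mulVec_single (Y : Matrix (Fin 3) (Fin 3) F) (i₀ : Fin 3) :
    (Pi.single i₀ (1 : F)) ⬝ᵥ ((((StdForm.antidiagonal 3).over F) * Y) *ᵥ (Pi.single i₀ 1)) = Y i₀.rev i₀ := by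
  rw [← Matrix.mulVec_mulVec, dotProduct_antidiagonal_three_mulVec_eq_sum, Matrix.mulVec_single, MulOpposite.op_one, one_smul]
  rw [Finset.sum_eq_single i₀]
  · simp
  · intro b _ hb; simp [Pi.single_eq_of_ne hb]
  · intro h; exact absurd (Finset.mem_univ _) h

/-- **ONE SQUARE CLASS OF NON-ZERO VALUES**: for a non-zero `J₀`-symmetric `Ȳ` of square zero there is `s₀ ≠ 0` such that a non-zero class `t·(𝓀ˣ)²` is taken by
`x̄ ↦ ᵗx̄ (J̄₀Ȳ) x̄` iff `s₀·t` is a non-zero square. [cite: BruhatTits1972, §10] [cite: Kottwitz1986, §3] [cite: Rogawski1990, §4.9 p. 55] -/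
theorem exists_forall_represents_iff_of_symm_of_mul_self_eq_zero (Y : Matrix (Fin 3) (Fin 3) F) (hsymm : ∀ i j, Y i j = Y j.rev i.rev) (hsq : Y * Y = 0)
    (hne : Y ≠ 0) :
    ∃ s₀ : F, s₀ ≠ 0 ∧ ∀ t : F, t ≠ 0 →
      ((∃ x : Fin 3 → F, ∃ a : F, a ≠ 0 ∧ x ⬝ᵥ ((((StdForm.antidiagonal 3).over F) * Y) *ᵥ x) = t * a ^ 2) ↔ ∃ z : F, z ≠ 0 ∧ s₀ * t = z ^ 2) := by
  obtain ⟨i₀, hi₀⟩ := exists_apply_rev_ne_zero_of_symm_of_mul_self_eq_zero Y hsymm hsq hne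
  refine ⟨Y i₀.rev i₀, hi₀, fun t ht => ⟨?_, ?_⟩⟩
  · rintro ⟨x, a, ha, hx⟩
    have hsq' := apply_rev_mul_dotProduct_eq_sq Y hsymm hsq i₀ x
    rw [hx] at hsq'
    -- `s₀ t a² = ℓ²`, so `s₀ t = (ℓ / a)²`, and `ℓ ≠ 0`
    refine ⟨(∑ b, Y i₀.rev b * x b) / a, ?_, ?_⟩
    · intro h0
      rw [div_eq_zero_iff] at h0
      rcases h0 with h0 | h0
      · rw [h0, zero_pow two_ne_zero] at hsq'
        exact (mul_ne_zero (mul_ne_zero hi₀ ht) (pow_ne_zero 2 ha)) (by rw [mul_assoc]; exact hsq')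
      · exact ha h0
    · rw [div_pow, ← hsq']; field_simp
  · rintro ⟨z, hz, hzt⟩
    -- at `e_{i₀}` the value is `s₀ = t · (z / t)²`
    refine ⟨Pi.single i₀ 1, z / t, div_ne_zero hz ht, ?_⟩
    rw [single_dotProduct_antidiagonal_mul_mulVec_single, div_pow, ← hzt]
    field_simp

/-- **THE SQUARE-CLASS DICHOTOMY OVER A FINITE FIELD OF ODD CHARACTERISTIC**: for `c ≠ 0` and a non-square `ε`, exactly one of «`c·(𝓀ˣ)²` is taken», «`cε·(𝓀ˣ)²` is taken»
holds for the quadratic form of a non-zero `J₀`-symmetric `Ȳ` of square zero. [cite: Rogawski1990, §4.9 p. 55] [cite: Kottwitz1986, §3] -/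
theorem represents_xor_represents_mul_of_symm_of_mul_self_eq_zero [Finite F] (Y : Matrix (Fin 3) (Fin 3) F)
    (hsymm : ∀ i j, Y i j = Y j.rev i.rev) (hsq : Y * Y = 0) (hne : Y ≠ 0) {c ε : F} (hc : c ≠ 0) (hε : ¬ IsSquare ε) :
    ((∃ x : Fin 3 → F, ∃ a : F, a ≠ 0 ∧ x ⬝ᵥ ((((StdForm.antidiagonal 3).over F) * Y) *ᵥ x) = c * a ^ 2) ∨
        (∃ x : Fin 3 → F, ∃ a : F, a ≠ 0 ∧ x ⬝ᵥ ((((StdForm.antidiagonal 3).over F) * Y) *ᵥ x) = (c * ε) * a ^ 2)) ∧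
      ¬ ((∃ x : Fin 3 → F, ∃ a : F, a ≠ 0 ∧ x ⬝ᵥ ((((StdForm.antidiagonal 3).over F) * Y) *ᵥ x) = c * a ^ 2) ∧
        (∃ x : Fin 3 → F, ∃ a : F, a ≠ 0 ∧ x ⬝ᵥ ((((StdForm.antidiagonal 3).over F) * Y) *ᵥ x) = (c * ε) * a ^ 2)) := by
  classical
  haveI : Fintype F := Fintype.ofFinite F
  have hε0 : ε ≠ 0 := fun h => hε (h ▸ IsSquare.zero)
  obtain ⟨s₀, hs₀, hrep⟩ := exists_forall_represents_iff_of_symm_of_mul_self_eq_zero Y hsymm hsq hne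
  rw [hrep c hc, hrep (c * ε) (mul_ne_zero hc hε0)]
  -- squares: `s₀ c ε = z²` with `s₀ c = z′²` would make `ε` a square
  have key : ∀ t : F, t ≠ 0 → ((∃ z : F, z ≠ 0 ∧ t = z ^ 2) ↔ IsSquare t) := by
    intro t ht
    constructor
    · rintro ⟨z, -, rfl⟩; exact ⟨z, by ring⟩
    · rintro ⟨z, rfl⟩
      refine ⟨z, fun h0 => ht (by rw [h0, mul_zero]), by ring⟩
  rw [key _ (mul_ne_zero hs₀ hc), key _ (mul_ne_zero hs₀ (mul_ne_zero hc hε0))]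
  have hχε : quadraticChar F ε = -1 := (quadraticChar_neg_one_iff_not_isSquare).2 hε
  constructor
  · by_cases hsc : IsSquare (s₀ * c)
    · exact Or.inl hsc
    · right
      rw [← quadraticChar_one_iff_isSquare (mul_ne_zero hs₀ (mul_ne_zero hc hε0)), ← mul_assoc, map_mul,
        (quadraticChar_neg_one_iff_not_isSquare).2 hsc, hχε]
      norm_num
  · rintro ⟨h1, h2'⟩
    rw [← quadraticChar_one_iff_isSquare (mul_ne_zero hs₀ hc)] at h1
    rw [← quadraticChar_one_iff_isSquare (mul_ne_zero hs₀ (mul_ne_zero hc hε0)), ← mul_assoc, map_mul, h1, hχε] at h2'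
    norm_num at h2'

end Residual


variable {K : Type*} [Field K] [Valued K ℤᵐ⁰] {σ : K →+* K} {ϖ : K}

/-! ## §2 From the depth-`d` tokens of `Y = γ′ − 1` (valuation level) to the residual matrix `Ȳ = red(ϖ^{−d}·Y)` -/

/-- The leading matrix `Y₀ = ϖ^{−d}·M` is integral when `|M_{ij}| ≤ |ϖ|^d` (spelled as an `𝒪`-valued matrix with the G3⁗ hypothesis `hY₀`). [cite: Tits1979, §3.5] [cite: Kottwitz1986, §3] -/
theorem exists_integer_matrix_eq_inv_pow_mul (hϖ : Valued.v ϖ = WithZero.exp (-1 : ℤ)) {d : ℕ} (M : Matrix (Fin 3) (Fin 3) K)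
    (hM : ∀ i j, Valued.v (M i j) ≤ Valued.v ϖ ^ d) :
    ∃ Y₀ : Matrix (Fin 3) (Fin 3) 𝒪[K], ∀ i j, ((Y₀ i j : 𝒪[K]) : K) = (ϖ ^ d)⁻¹ * M i j := by
  have hϖ0 : ϖ ≠ 0 := fun h0 => by rw [h0, map_zero] at hϖ; exact WithZero.coe_ne_zero hϖ.symm
  have hvϖ0 : Valued.v ϖ ≠ 0 := (Valuation.ne_zero_iff _).2 hϖ0
  have hint : ∀ i j, Valued.v ((ϖ ^ d)⁻¹ * M i j) ≤ 1 := fun i j => by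
    rw [map_mul, map_inv₀, map_pow]
    calc (Valued.v ϖ ^ d)⁻¹ * Valued.v (M i j) ≤ (Valued.v ϖ ^ d)⁻¹ * Valued.v ϖ ^ d := mul_le_mul' le_rfl (hM i j)
      _ = 1 := inv_mul_cancel₀ (pow_ne_zero _ hvϖ0)
  exact ⟨fun i j => ⟨(ϖ ^ d)⁻¹ * M i j, (Valuation.mem_integer_iff _ _).2 (hint i j)⟩, fun i j => rfl⟩

/-- **`LEV₂ (ϖ^{2d+1})` ⇒ `Ȳ² = 0`**: if `|(M²)_{ij}| ≤ |ϖ|^{2d+1}` then the residual leading matrix has square zero. [cite: Tits1979, §3.5] [cite: Kottwitz1986, §3] -/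
theorem map_residue_mul_self_eq_zero_of_sq_le (hϖ : Valued.v ϖ = WithZero.exp (-1 : ℤ)) {d : ℕ} (M : Matrix (Fin 3) (Fin 3) K) (Y₀ : Matrix (Fin 3) (Fin 3) 𝒪[K])
    (hY₀ : ∀ i j, ((Y₀ i j : 𝒪[K]) : K) = (ϖ ^ d)⁻¹ * M i j) (hsq : ∀ i j, Valued.v ((M * M) i j) ≤ Valued.v ϖ ^ (2 * d + 1)) :
    Y₀.map (IsLocalRing.residue 𝒪[K]) * Y₀.map (IsLocalRing.residue 𝒪[K]) = 0 := by
  have hϖ0 : ϖ ≠ 0 := fun h0 => by rw [h0, map_zero] at hϖ; exact WithZero.coe_ne_zero hϖ.symm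
  have hvϖ0 : Valued.v ϖ ≠ 0 := (Valuation.ne_zero_iff _).2 hϖ0
  have hϖlt : Valued.v ϖ < 1 := by rw [hϖ, ← WithZero.exp_zero]; exact WithZero.exp_lt_exp.2 (by norm_num)
  rw [← Matrix.map_mul]
  ext i j
  rw [Matrix.map_apply, Matrix.zero_apply, residue_eq_zero_iff_v_lt_one]
  have hcoe : (((Y₀ * Y₀) i j : 𝒪[K]) : K) = (ϖ ^ d)⁻¹ * ((ϖ ^ d)⁻¹ * (M * M) i j) := by
    rw [Matrix.mul_apply, Matrix.mul_apply]
    push_cast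
    simp only [hY₀, Finset.mul_sum]
    exact Finset.sum_congr rfl fun k _ => by ring
  have hbd : Valued.v ((M * M) i j) ≤ Valued.v ϖ ^ d * (Valued.v ϖ ^ d * Valued.v ϖ) := by
    have h := hsq i j
    rwa [pow_succ, two_mul, pow_add, mul_assoc] at h
  rw [hcoe, map_mul, map_mul, map_inv₀, map_pow]
  calc (Valued.v ϖ ^ d)⁻¹ * ((Valued.v ϖ ^ d)⁻¹ * Valued.v ((M * M) i j))
      ≤ (Valued.v ϖ ^ d)⁻¹ * ((Valued.v ϖ ^ d)⁻¹ * (Valued.v ϖ ^ d * (Valued.v ϖ ^ d * Valued.v ϖ))) := mul_le_mul' le_rfl (mul_le_mul' le_rfl hbd)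
    _ = Valued.v ϖ := by rw [inv_mul_cancel_left₀ (pow_ne_zero _ hvϖ0), inv_mul_cancel_left₀ (pow_ne_zero _ hvϖ0)]
    _ < 1 := hϖlt

/-- **Symmetry one order down ⇒ `Ȳ` is `J₀`-symmetric**: if `|M_{ij} − M_{rev j, rev i}| ≤ |ϖ|^{d+1}` then `Ȳ_{ij} = Ȳ_{rev j, rev i}`. [cite: Tits1979, §3.5] [cite: BruhatTits1972, §10] -/
theorem map_residue_apply_eq_rev_of_sub_le (hϖ : Valued.v ϖ = WithZero.exp (-1 : ℤ)) {d : ℕ} (M : Matrix (Fin 3) (Fin 3) K) (Y₀ : Matrix (Fin 3) (Fin 3) 𝒪[K])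
    (hY₀ : ∀ i j, ((Y₀ i j : 𝒪[K]) : K) = (ϖ ^ d)⁻¹ * M i j) (hsymm : ∀ i j, Valued.v (M i j - M j.rev i.rev) ≤ Valued.v ϖ ^ (d + 1)) (i j : Fin 3) :
    Y₀.map (IsLocalRing.residue 𝒪[K]) i j = Y₀.map (IsLocalRing.residue 𝒪[K]) j.rev i.rev := by
  have hϖ0 : ϖ ≠ 0 := fun h0 => by rw [h0, map_zero] at hϖ; exact WithZero.coe_ne_zero hϖ.symm
  have hvϖ0 : Valued.v ϖ ≠ 0 := (Valuation.ne_zero_iff _).2 hϖ0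
  have hϖlt : Valued.v ϖ < 1 := by rw [hϖ, ← WithZero.exp_zero]; exact WithZero.exp_lt_exp.2 (by norm_num)
  rw [Matrix.map_apply, Matrix.map_apply]
  apply residue_eq_of_v_sub_lt_one
  rw [hY₀, hY₀, ← mul_sub, map_mul, map_inv₀, map_pow]
  calc (Valued.v ϖ ^ d)⁻¹ * Valued.v (M i j - M j.rev i.rev) ≤ (Valued.v ϖ ^ d)⁻¹ * (Valued.v ϖ ^ d * Valued.v ϖ) :=
        mul_le_mul' le_rfl (by rw [← pow_succ]; exact hsymm i j)
    _ = Valued.v ϖ := by rw [inv_mul_cancel_left₀ (pow_ne_zero _ hvϖ0)]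
    _ < 1 := hϖlt

/-- **Exact depth `d` ⇒ `Ȳ ≠ 0`**: if NOT all `|M_{ij}| ≤ |ϖ|^{d+1}` then the residual leading matrix is non-zero (discreteness of the valuation). [cite: Serre1980Trees, II.1.1] [cite: Kottwitz1986, §3] -/
theorem map_residue_ne_zero_of_not_forall_le_succ (hϖ : Valued.v ϖ = WithZero.exp (-1 : ℤ)) {d : ℕ} (M : Matrix (Fin 3) (Fin 3) K) (Y₀ : Matrix (Fin 3) (Fin 3) 𝒪[K])
    (hY₀ : ∀ i j, ((Y₀ i j : 𝒪[K]) : K) = (ϖ ^ d)⁻¹ * M i j) (hne : ¬ ∀ i j, Valued.v (M i j) ≤ Valued.v ϖ ^ (d + 1)) :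
    Y₀.map (IsLocalRing.residue 𝒪[K]) ≠ 0 := by
  have hϖ0 : ϖ ≠ 0 := fun h0 => by rw [h0, map_zero] at hϖ; exact WithZero.coe_ne_zero hϖ.symm
  have hvϖ0 : Valued.v ϖ ≠ 0 := (Valuation.ne_zero_iff _).2 hϖ0
  intro h0
  apply hne
  intro i j
  have hij : IsLocalRing.residue 𝒪[K] (Y₀ i j) = 0 := by
    have h := congr_fun (congr_fun h0 i) j
    rwa [Matrix.map_apply, Matrix.zero_apply] at h
  rw [residue_eq_zero_iff_v_lt_one, hY₀] at hij
  have h1 : (1 : ℤᵐ⁰) = Valued.v ϖ * WithZero.exp (1 : ℤ) := by rw [hϖ, ← WithZero.exp_add]; norm_num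
  rw [h1] at hij
  have hle := (WithZero.lt_mul_exp_iff_le hvϖ0).1 hij
  rw [map_mul, map_inv₀, map_pow] at hle
  have h := mul_le_mul' (le_refl (Valued.v ϖ ^ d)) hle
  rwa [mul_inv_cancel_left₀ (pow_ne_zero _ hvϖ0), ← pow_succ] at h

/-- **THE CLASS TOKEN AT `L₀` READ RESIDUALLY** (G3⁗ dictionary, any matrix `M` with integral leading term `Y₀ = ϖ^{−d}M`): «some `x ∈ 𝒪³` has `|ϖ^{−d}·B₀(x, Mx) − t·a²| < 1`
with `|a| = 1`» iff «some `x̄ ∈ 𝓀³` has `ᵗx̄ (J̄₀Ȳ) x̄ = t̄·ā²` with `ā ≠ 0`». [cite: Tits1979, §3.5] [cite: Kottwitz1986, §3] [cite: Rogawski1990, §4.9 p. 55] -/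
theorem exists_mem_stdLattice_depthClass_iff_residue (hvσ : ∀ a, Valued.v (σ a) = Valued.v a) (hres : ∀ x : K, Valued.v x ≤ 1 → Valued.v (σ x - x) < 1)
    (hϖ : Valued.v ϖ = WithZero.exp (-1 : ℤ)) {d : ℕ} (M : Matrix (Fin 3) (Fin 3) K) (Y₀ : Matrix (Fin 3) (Fin 3) 𝒪[K])
    (hY₀ : ∀ i j, ((Y₀ i j : 𝒪[K]) : K) = (ϖ ^ d)⁻¹ * M i j) (t : K) (ht : Valued.v t ≤ 1) :
    (∃ x ∈ stdLattice K 3, ∃ a : K, Valued.v a = 1 ∧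
        Valued.v ((ϖ ^ d)⁻¹ * pairing σ ((StdForm.antidiagonal 3).over K) x (M *ᵥ x) - t * a ^ 2) < 1) ↔
      ∃ x : Fin 3 → 𝓀[K], ∃ a : 𝓀[K], a ≠ 0 ∧
        x ⬝ᵥ ((((StdForm.antidiagonal 3).over 𝓀[K]) * Y₀.map (IsLocalRing.residue 𝒪[K])) *ᵥ x) =
          IsLocalRing.residue 𝒪[K] ⟨t, (Valuation.mem_integer_iff _ _).2 ht⟩ * a ^ 2 := by
  have hϖ0 : ϖ ≠ 0 := fun h0 => by rw [h0, map_zero] at hϖ; exact WithZero.coe_ne_zero hϖ.symm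
  constructor
  · rintro ⟨x, hx, a, ha, hlt⟩
    set x₀ : Fin 3 → 𝒪[K] := fun i => ⟨x i, (Valuation.mem_integer_iff _ _).2 ((mem_stdLattice).1 hx i)⟩ with hx₀def
    obtain ⟨tt, htt, hrt⟩ := exists_integer_eq_test_and_residue_eq hvσ hres hϖ0 M Y₀ hY₀ x₀
    refine ⟨fun i => IsLocalRing.residue 𝒪[K] (x₀ i), ?_⟩
    rw [← hrt]
    refine (exists_unit_v_sub_mul_sq_lt_one_iff_residue tt ⟨t, (Valuation.mem_integer_iff _ _).2 ht⟩).1 ⟨a, ha, ?_⟩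
    rw [htt]
    rw [pairing_antidiagonal] at hlt
    exact hlt
  · rintro ⟨xb, a, ha, heq⟩
    choose x₀ hx₀ using fun i => IsLocalRing.residue_surjective (xb i)
    have hxb : (fun i => IsLocalRing.residue 𝒪[K] (x₀ i)) = xb := funext hx₀
    obtain ⟨tt, htt, hrt⟩ := exists_integer_eq_test_and_residue_eq hvσ hres hϖ0 M Y₀ hY₀ x₀
    rw [hxb] at hrt
    obtain ⟨a₀, ha₀, hlt⟩ := (exists_unit_v_sub_mul_sq_lt_one_iff_residue tt ⟨t, (Valuation.mem_integer_iff _ _).2 ht⟩).2 ⟨a, ha, by rw [hrt, heq]⟩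
    refine ⟨fun i => (x₀ i : K), (mem_stdLattice).2 fun i => (x₀ i).2, a₀, ha₀, ?_⟩
    rw [pairing_antidiagonal, ← htt]
    exact hlt

/-- **THE CLASS TOKEN AT `u·L₀` IS THE CLASS TOKEN AT `L₀` FOR `u⁻¹γu`** (`u` unitary: `B₀(u x, (γ − 1) u x) = B₀(x, (u⁻¹γu − 1) x)`; any scalar `r`, any constant `t`).
[cite: BruhatTits1972, §10] [cite: Kottwitz1986, §3] -/
theorem exists_mem_mapGL_stdLattice_depthClass_iff (u γ : unitaryGroupOfForm σ ((StdForm.antidiagonal 3).over K)) (r t : K) :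
    (∃ y ∈ mapGL (u : GL (Fin 3) K) (stdLattice K 3), ∃ a : K, Valued.v a = 1 ∧
        Valued.v (r * pairing σ ((StdForm.antidiagonal 3).over K) y ((((γ : GL (Fin 3) K) : Matrix (Fin 3) (Fin 3) K) - 1) *ᵥ y) - t * a ^ 2) < 1) ↔
      ∃ x ∈ stdLattice K 3, ∃ a : K, Valued.v a = 1 ∧
        Valued.v (r * pairing σ ((StdForm.antidiagonal 3).over K) x
          (((((u⁻¹ * γ * u : unitaryGroupOfForm σ ((StdForm.antidiagonal 3).over K)) : GL (Fin 3) K) : Matrix (Fin 3) (Fin 3) K) - 1) *ᵥ x) - t * a ^ 2) < 1 := by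
  have hmat : ∀ x : Fin 3 → K,
      ((((γ : GL (Fin 3) K) : Matrix (Fin 3) (Fin 3) K) - 1) *ᵥ (((u : GL (Fin 3) K) : Matrix (Fin 3) (Fin 3) K) *ᵥ x)) =
        ((u : GL (Fin 3) K) : Matrix (Fin 3) (Fin 3) K) *ᵥ
          (((((u⁻¹ * γ * u : unitaryGroupOfForm σ ((StdForm.antidiagonal 3).over K)) : GL (Fin 3) K) : Matrix (Fin 3) (Fin 3) K) - 1) *ᵥ x) := by
    intro x
    rw [coe_inv_mul_mul_sub_one, Matrix.mulVec_mulVec, Matrix.mulVec_mulVec, ← Matrix.mul_assoc, ← Matrix.mul_assoc, ← Units.val_mul, mul_inv_cancel,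
      Units.val_one, Matrix.one_mul]
  have hinv : ∀ y : Fin 3 → K, ((u : GL (Fin 3) K) : Matrix (Fin 3) (Fin 3) K) *ᵥ ((((u : GL (Fin 3) K)⁻¹ : GL (Fin 3) K) : Matrix (Fin 3) (Fin 3) K) *ᵥ y) = y :=
    fun y => by rw [Matrix.mulVec_mulVec, ← Units.val_mul, mul_inv_cancel, Units.val_one, Matrix.one_mulVec]
  constructor
  · rintro ⟨y, hy, a, ha, hlt⟩
    rw [mem_mapGL_iff] at hy
    refine ⟨(((u : GL (Fin 3) K)⁻¹ : GL (Fin 3) K) : Matrix (Fin 3) (Fin 3) K) *ᵥ y, hy, a, ha, ?_⟩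
    rw [← pairing_mulVec_mulVec_of_mem_unitary u.2, ← hmat, hinv]
    exact hlt
  · rintro ⟨x, hx, a, ha, hlt⟩
    refine ⟨((u : GL (Fin 3) K) : Matrix (Fin 3) (Fin 3) K) *ᵥ x, ?_, a, ha, ?_⟩
    · rw [mem_mapGL_iff, Matrix.mulVec_mulVec, ← Units.val_mul, inv_mul_cancel, Units.val_one, Matrix.one_mulVec]
      exact hx
    · rw [hmat, pairing_mulVec_mulVec_of_mem_unitary u.2]
      exact hlt

/-! ## §3 ONE CLASS PER RANK-ONE VERTEX -/

/-- **ONE CLASS AT THE ROOT (matrix form).**  For `γ ∈ U(σ, J₀)`, `Y = γ − 1` with `|Y_{ij}| ≤ |ϖ|^d` (`d ≥ 1`), NOT all `≤ |ϖ|^{d+1}` (exact depth `d`) and `|(Y²)_{ij}| ≤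
|ϖ|^{2d+1}` (rank one), a unit `c` and a residual non-square unit `ε`: EXACTLY ONE of the classes `c`, `c·ε` is taken by `x ↦ ϖ^{−d}·B₀(x, Y x)` on `𝒪³` to first order.
(`d` is odd by ★ p847392; the residual `Ȳ` is `J₀`-symmetric (★ `v_coe_sub_one_apply_sub_rev_le_of_odd`), non-zero of square zero, so of rank one: §1.)
[cite: Rogawski1990, §4.9 p. 55] [cite: Kottwitz1986, §3] [cite: Tits1979, §3.5] [cite: BruhatTits1972, §10] -/
theorem class_xor_class_mul_stdLattice_of_rankOne (hvσ : ∀ a, Valued.v (σ a) = Valued.v a) (hσϖ : σ ϖ = -ϖ)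
    (hϖ : Valued.v ϖ = WithZero.exp (-1 : ℤ)) (hres : ∀ x : K, Valued.v x ≤ 1 → Valued.v (σ x - x) < 1) (h2 : Valued.v (2 : K) = 1) [Finite 𝓀[K]]
    (γ : unitaryGroupOfForm σ ((StdForm.antidiagonal 3).over K)) {d : ℕ} (hd1 : 1 ≤ d)
    (hY : ∀ i j, Valued.v ((((γ : GL (Fin 3) K) : Matrix (Fin 3) (Fin 3) K) - 1) i j) ≤ Valued.v ϖ ^ d)
    (hY' : ¬ ∀ i j, Valued.v ((((γ : GL (Fin 3) K) : Matrix (Fin 3) (Fin 3) K) - 1) i j) ≤ Valued.v ϖ ^ (d + 1))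
    (hsq : ∀ i j, Valued.v (((((γ : GL (Fin 3) K) : Matrix (Fin 3) (Fin 3) K) - 1) * ((((γ : GL (Fin 3) K) : Matrix (Fin 3) (Fin 3) K) - 1))) i j) ≤ Valued.v ϖ ^ (2 * d + 1))
    (c ε : K) (hc : Valued.v c = 1) (hεv : Valued.v ε = 1) (hε : ∀ z : K, Valued.v z ≤ 1 → Valued.v (z ^ 2 - ε) = 1) :
    ((∃ x ∈ stdLattice K 3, ∃ a : K, Valued.v a = 1 ∧
          Valued.v ((ϖ ^ d)⁻¹ * pairing σ ((StdForm.antidiagonal 3).over K) x ((((γ : GL (Fin 3) K) : Matrix (Fin 3) (Fin 3) K) - 1) *ᵥ x) - c * a ^ 2) < 1) ∨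
        (∃ x ∈ stdLattice K 3, ∃ a : K, Valued.v a = 1 ∧
          Valued.v ((ϖ ^ d)⁻¹ * pairing σ ((StdForm.antidiagonal 3).over K) x ((((γ : GL (Fin 3) K) : Matrix (Fin 3) (Fin 3) K) - 1) *ᵥ x) - (c * ε) * a ^ 2) < 1)) ∧
      ¬ ((∃ x ∈ stdLattice K 3, ∃ a : K, Valued.v a = 1 ∧
            Valued.v ((ϖ ^ d)⁻¹ * pairing σ ((StdForm.antidiagonal 3).over K) x ((((γ : GL (Fin 3) K) : Matrix (Fin 3) (Fin 3) K) - 1) *ᵥ x) - c * a ^ 2) < 1) ∧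
          (∃ x ∈ stdLattice K 3, ∃ a : K, Valued.v a = 1 ∧
            Valued.v ((ϖ ^ d)⁻¹ * pairing σ ((StdForm.antidiagonal 3).over K) x ((((γ : GL (Fin 3) K) : Matrix (Fin 3) (Fin 3) K) - 1) *ᵥ x) - (c * ε) * a ^ 2) < 1)) := by
  set Y : Matrix (Fin 3) (Fin 3) K := ((γ : GL (Fin 3) K) : Matrix (Fin 3) (Fin 3) K) - 1 with hYdef
  -- parity: `d` is odd (★ p847392: at even depth rank `≤ 1` forces depth `+1`)
  have hodd : Odd d := by
    rcases Nat.even_or_odd d with hev | hodd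
    · exact absurd (forall_v_coe_sub_one_le_succ_of_even_of_sq_le hvσ hσϖ hϖ hres h2 γ hev hd1 hY hsq) hY'
    · exact hodd
  -- the residual leading matrix
  obtain ⟨Y₀, hY₀⟩ := exists_integer_matrix_eq_inv_pow_mul hϖ Y hY
  have hsymm : ∀ i j, Y₀.map (IsLocalRing.residue 𝒪[K]) i j = Y₀.map (IsLocalRing.residue 𝒪[K]) j.rev i.rev :=
    map_residue_apply_eq_rev_of_sub_le hϖ Y Y₀ hY₀ (v_coe_sub_one_apply_sub_rev_le_of_odd hvσ hσϖ hϖ hres γ hodd hY)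
  have hsq0 := map_residue_mul_self_eq_zero_of_sq_le hϖ Y Y₀ hY₀ hsq
  have hne0 := map_residue_ne_zero_of_not_forall_le_succ hϖ Y Y₀ hY₀ hY'
  -- residues of the constants
  have hcε : Valued.v (c * ε) ≤ 1 := by rw [map_mul, hc, hεv, one_mul]
  have hc0 : IsLocalRing.residue 𝒪[K] ⟨c, (Valuation.mem_integer_iff _ _).2 hc.le⟩ ≠ 0 := by
    rw [Ne, residue_eq_zero_iff_v_lt_one]
    exact fun h => (ne_of_lt h) hc
  have hεns : ¬ IsSquare (IsLocalRing.residue 𝒪[K] ⟨ε, (Valuation.mem_integer_iff _ _).2 hεv.le⟩) := by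
    rintro ⟨r, hr⟩
    obtain ⟨z, rfl⟩ := IsLocalRing.residue_surjective r
    have h1 := hε z z.2
    have h0 : IsLocalRing.residue 𝒪[K] (z ^ 2 - ⟨ε, (Valuation.mem_integer_iff _ _).2 hεv.le⟩) = 0 := by
      rw [map_sub, map_pow, hr, pow_two, sub_self]
    rw [residue_eq_zero_iff_v_lt_one] at h0
    push_cast at h0
    exact (ne_of_lt h0) h1
  have hmul : IsLocalRing.residue 𝒪[K] ⟨c * ε, (Valuation.mem_integer_iff _ _).2 hcε⟩ =
      IsLocalRing.residue 𝒪[K] ⟨c, (Valuation.mem_integer_iff _ _).2 hc.le⟩ * IsLocalRing.residue 𝒪[K] ⟨ε, (Valuation.mem_integer_iff _ _).2 hεv.le⟩ := by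
    rw [← map_mul]; rfl
  have hR := represents_xor_represents_mul_of_symm_of_mul_self_eq_zero (Y₀.map (IsLocalRing.residue 𝒪[K])) hsymm hsq0 hne0 hc0 hεns
  rw [exists_mem_stdLattice_depthClass_iff_residue hvσ hres hϖ Y Y₀ hY₀ c hc.le, exists_mem_stdLattice_depthClass_iff_residue hvσ hres hϖ Y Y₀ hY₀ (c * ε) hcε, hmul]
  exact hR

/-- **ROW-1C «ONE CLASS PER RANK-ONE VERTEX»** (J-PACK v2 socket `row_oneClass`, F0P3a-p01 (g17)): at a self-dual vertex `w` of the `J₀`-model fixed by `γ ∈ U(σ, J₀)`, of exact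
depth `d ≥ 1` (`LEV (ϖ^d)`, `¬ LEV (ϖ^{d+1})`) and rank one (`LEV₂ (ϖ^{2d+1})`), for a unit `c` and a residual non-square unit `ε`: EXACTLY ONE of the class tokens `CLS[w] d c`,
`CLS[w] d (c·ε)` holds — the depth-`d` unit values `ϖ^{−d}·B₀(y, (γ − 1)y)`, `y ∈ w`, form ONE square class.  (`w = u·L₀` by transitivity ★ `exists_latticeGraphIso_root_eq_of_v_two`,
then the matrix form for `u⁻¹γu`; the fixedness, integrality and nilpotency hypotheses of the socket are carried but not needed.)
[cite: Rogawski1990, §4.9 p. 55] [cite: Kottwitz1986, §3] [cite: Tits1979, §3.5] [cite: BruhatTits1972, §10] -/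
theorem class_xor_class_mul_of_fixed_selfDual_rankOne (hσ : ∀ x, σ (σ x) = x) (hvσ : ∀ a, Valued.v (σ a) = Valued.v a) (hσϖ : σ ϖ = -ϖ)
    (hϖ : Valued.v ϖ = WithZero.exp (-1 : ℤ)) (hres : ∀ x : K, Valued.v x ≤ 1 → Valued.v (σ x - x) < 1) (h2 : Valued.v (2 : K) = 1) [Finite 𝓀[K]]
    {γ : unitaryGroupOfForm σ ((StdForm.antidiagonal 3).over K)} (_hγ0 : γ ∈ unitaryInt σ ((StdForm.antidiagonal 3).over K))
    {w : {M : Submodule 𝒪[K] (Fin 3 → K) // IsVertex σ ϖ ((StdForm.antidiagonal 3).over K) M}} (hw : IsSelfDualLattice σ ϖ ((StdForm.antidiagonal 3).over K) w.1) (_hfix : latticeGraphIso σ ϖ ((StdForm.antidiagonal 3).over K) γ w = w)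
    {d : ℕ} (hd1 : 1 ≤ d)
    (hlev : w.1.map ((Matrix.toLin' (((γ : GL (Fin 3) K) : Matrix (Fin 3) (Fin 3) K) - 1)).restrictScalars 𝒪[K]) ≤ scaleLattice (ϖ ^ d) w.1) (hlev' : ¬ w.1.map ((Matrix.toLin' (((γ : GL (Fin 3) K) : Matrix (Fin 3) (Fin 3) K) - 1)).restrictScalars 𝒪[K]) ≤ scaleLattice (ϖ ^ (d + 1)) w.1) (hrk : w.1.map ((Matrix.toLin' ((((γ : GL (Fin 3) K) : Matrix (Fin 3) (Fin 3) K) - 1) ^ 2)).restrictScalars 𝒪[K]) ≤ scaleLattice (ϖ ^ (2 * d + 1)) w.1) (_hnil : w.1.map ((Matrix.toLin' ((((γ : GL (Fin 3) K) : Matrix (Fin 3) (Fin 3) K) - 1) ^ 3)).restrictScalars 𝒪[K]) ≤ scaleLattice (ϖ ^ (3 * d + 1)) w.1)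
    (c ε : K) (hc : Valued.v c = 1) (hεv : Valued.v ε = 1) (hε : ∀ z : K, Valued.v z ≤ 1 → Valued.v (z ^ 2 - ε) = 1) :
    ((∃ y ∈ w.1, ∃ a : K, Valued.v a = 1 ∧ Valued.v ((ϖ ^ (d))⁻¹ * pairing σ ((StdForm.antidiagonal 3).over K) y ((((γ : GL (Fin 3) K) : Matrix (Fin 3) (Fin 3) K) - 1) *ᵥ y) - (c) * a ^ 2) < 1) ∨ (∃ y ∈ w.1, ∃ a : K, Valued.v a = 1 ∧ Valued.v ((ϖ ^ (d))⁻¹ * pairing σ ((StdForm.antidiagonal 3).over K) y ((((γ : GL (Fin 3) K) : Matrix (Fin 3) (Fin 3) K) - 1) *ᵥ y) - (c * ε) * a ^ 2) < 1)) ∧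
      ¬ ((∃ y ∈ w.1, ∃ a : K, Valued.v a = 1 ∧ Valued.v ((ϖ ^ (d))⁻¹ * pairing σ ((StdForm.antidiagonal 3).over K) y ((((γ : GL (Fin 3) K) : Matrix (Fin 3) (Fin 3) K) - 1) *ᵥ y) - (c) * a ^ 2) < 1) ∧ (∃ y ∈ w.1, ∃ a : K, Valued.v a = 1 ∧ Valued.v ((ϖ ^ (d))⁻¹ * pairing σ ((StdForm.antidiagonal 3).over K) y ((((γ : GL (Fin 3) K) : Matrix (Fin 3) (Fin 3) K) - 1) *ᵥ y) - (c * ε) * a ^ 2) < 1)) := by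
  have hϖ0 : ϖ ≠ 0 := fun h0 => by rw [h0, map_zero] at hϖ; exact WithZero.coe_ne_zero hϖ.symm
  -- `w = u·L₀`
  obtain ⟨u, hu⟩ := exists_latticeGraphIso_root_eq_of_v_two hσ hvσ hϖ h2 w hw (isSelfDualLattice_stdLattice_three_of_v hϖ)
  subst hu
  -- the tokens as matrix bounds on `γ′ − 1`, `γ′ = u⁻¹γu`
  have hY : ∀ i j, Valued.v (((((u⁻¹ * γ * u : unitaryGroupOfForm σ ((StdForm.antidiagonal 3).over K)) : GL (Fin 3) K) : Matrix (Fin 3) (Fin 3) K) - 1) i j) ≤ Valued.v ϖ ^ d :=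
    fun i j => by rw [← map_pow]; exact (forall_v_conj_sub_one_le_iff_map_sub_one_le_scaleLattice γ u (pow_ne_zero _ hϖ0)).1 hlev i j
  have hY' : ¬ ∀ i j, Valued.v (((((u⁻¹ * γ * u : unitaryGroupOfForm σ ((StdForm.antidiagonal 3).over K)) : GL (Fin 3) K) : Matrix (Fin 3) (Fin 3) K) - 1) i j) ≤ Valued.v ϖ ^ (d + 1) :=
    fun h => hlev' ((forall_v_conj_sub_one_le_iff_map_sub_one_le_scaleLattice γ u (pow_ne_zero _ hϖ0)).2 fun i j => by rw [map_pow]; exact h i j)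
  have hu' : IsUnit ((u : GL (Fin 3) K) : Matrix (Fin 3) (Fin 3) K).det := Matrix.isUnits_det_units _
  have hconj : ((u : GL (Fin 3) K) : Matrix (Fin 3) (Fin 3) K)⁻¹ * (((γ : GL (Fin 3) K) : Matrix (Fin 3) (Fin 3) K) - 1) * ((u : GL (Fin 3) K) : Matrix (Fin 3) (Fin 3) K) =
      (((u⁻¹ * γ * u : unitaryGroupOfForm σ ((StdForm.antidiagonal 3).over K)) : GL (Fin 3) K) : Matrix (Fin 3) (Fin 3) K) - 1 := by
    rw [coe_inv_mul_mul_sub_one, Matrix.coe_units_inv]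
  have hrk' : (latt ((u : GL (Fin 3) K) : Matrix (Fin 3) (Fin 3) K)).map ((Matrix.toLin' ((((γ : GL (Fin 3) K) : Matrix (Fin 3) (Fin 3) K) - 1) ^ 2)).restrictScalars 𝒪[K]) ≤
      scaleLattice (ϖ ^ (2 * d + 1)) (latt ((u : GL (Fin 3) K) : Matrix (Fin 3) (Fin 3) K)) := hrk
  rw [map_toLin'_latt_le_scaleLattice_iff (pow_ne_zero _ hϖ0) _ hu', inv_mul_sq_mul_eq_sq _ hu', hconj] at hrk'
  have hsq : ∀ i j, Valued.v ((((((u⁻¹ * γ * u : unitaryGroupOfForm σ ((StdForm.antidiagonal 3).over K)) : GL (Fin 3) K) : Matrix (Fin 3) (Fin 3) K) - 1) *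
      ((((u⁻¹ * γ * u : unitaryGroupOfForm σ ((StdForm.antidiagonal 3).over K)) : GL (Fin 3) K) : Matrix (Fin 3) (Fin 3) K) - 1)) i j) ≤ Valued.v ϖ ^ (2 * d + 1) :=
    fun i j => by rw [← pow_two, ← map_pow]; exact hrk' i j
  have h1 := class_xor_class_mul_stdLattice_of_rankOne hvσ hσϖ hϖ hres h2 (u⁻¹ * γ * u) hd1 hY hY' hsq c ε hc hεv hε
  have e1 := exists_mem_mapGL_stdLattice_depthClass_iff u γ ((ϖ ^ d)⁻¹) c
  have e2 := exists_mem_mapGL_stdLattice_depthClass_iff u γ ((ϖ ^ d)⁻¹) (c * ε)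
  have hw1 : (latticeGraphIso σ ϖ ((StdForm.antidiagonal 3).over K) u ⟨stdLattice K 3, 0, isSelfDualLattice_stdLattice_three_of_v hϖ⟩).1 =
      mapGL (u : GL (Fin 3) K) (stdLattice K 3) := rfl
  rw [hw1, e1, e2]
  exact h1

/-! ## §4 (ED. 2) The same without the idle socket binders -/

/-- **ONE CLASS PER RANK-ONE VERTEX, lean binders** (ED. 2): the statement of `class_xor_class_mul_of_fixed_selfDual_rankOne` WITHOUT the socket's idle hypotheses
`hγ0` (integrality), `hfix` (fixedness) and `hnil` (`LEV₃ (ϖ^{3d+1})`) — so a consumer at depth `1` (the junction's L1 `hstr_of_labels`) need not run ROW-N to produce `hnil`.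
[cite: Rogawski1990, §4.9 p. 55] [cite: Kottwitz1986, §3] [cite: Tits1979, §3.5] [cite: BruhatTits1972, §10] -/
theorem class_xor_class_mul_of_selfDual_rankOne (hσ : ∀ x, σ (σ x) = x) (hvσ : ∀ a, Valued.v (σ a) = Valued.v a) (hσϖ : σ ϖ = -ϖ)
    (hϖ : Valued.v ϖ = WithZero.exp (-1 : ℤ)) (hres : ∀ x : K, Valued.v x ≤ 1 → Valued.v (σ x - x) < 1) (h2 : Valued.v (2 : K) = 1) [Finite 𝓀[K]]
    (γ : unitaryGroupOfForm σ ((StdForm.antidiagonal 3).over K))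
    {w : {M : Submodule 𝒪[K] (Fin 3 → K) // IsVertex σ ϖ ((StdForm.antidiagonal 3).over K) M}} (hw : IsSelfDualLattice σ ϖ ((StdForm.antidiagonal 3).over K) w.1)
    {d : ℕ} (hd1 : 1 ≤ d)
    (hlev : w.1.map ((Matrix.toLin' (((γ : GL (Fin 3) K) : Matrix (Fin 3) (Fin 3) K) - 1)).restrictScalars 𝒪[K]) ≤ scaleLattice (ϖ ^ d) w.1)
    (hlev' : ¬ w.1.map ((Matrix.toLin' (((γ : GL (Fin 3) K) : Matrix (Fin 3) (Fin 3) K) - 1)).restrictScalars 𝒪[K]) ≤ scaleLattice (ϖ ^ (d + 1)) w.1)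
    (hrk : w.1.map ((Matrix.toLin' ((((γ : GL (Fin 3) K) : Matrix (Fin 3) (Fin 3) K) - 1) ^ 2)).restrictScalars 𝒪[K]) ≤ scaleLattice (ϖ ^ (2 * d + 1)) w.1)
    (c ε : K) (hc : Valued.v c = 1) (hεv : Valued.v ε = 1) (hε : ∀ z : K, Valued.v z ≤ 1 → Valued.v (z ^ 2 - ε) = 1) :
    ((∃ y ∈ w.1, ∃ a : K, Valued.v a = 1 ∧ Valued.v ((ϖ ^ d)⁻¹ * pairing σ ((StdForm.antidiagonal 3).over K) y ((((γ : GL (Fin 3) K) : Matrix (Fin 3) (Fin 3) K) - 1) *ᵥ y) - c * a ^ 2) < 1) ∨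
        (∃ y ∈ w.1, ∃ a : K, Valued.v a = 1 ∧ Valued.v ((ϖ ^ d)⁻¹ * pairing σ ((StdForm.antidiagonal 3).over K) y ((((γ : GL (Fin 3) K) : Matrix (Fin 3) (Fin 3) K) - 1) *ᵥ y) - (c * ε) * a ^ 2) < 1)) ∧
      ¬ ((∃ y ∈ w.1, ∃ a : K, Valued.v a = 1 ∧ Valued.v ((ϖ ^ d)⁻¹ * pairing σ ((StdForm.antidiagonal 3).over K) y ((((γ : GL (Fin 3) K) : Matrix (Fin 3) (Fin 3) K) - 1) *ᵥ y) - c * a ^ 2) < 1) ∧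
        (∃ y ∈ w.1, ∃ a : K, Valued.v a = 1 ∧ Valued.v ((ϖ ^ d)⁻¹ * pairing σ ((StdForm.antidiagonal 3).over K) y ((((γ : GL (Fin 3) K) : Matrix (Fin 3) (Fin 3) K) - 1) *ᵥ y) - (c * ε) * a ^ 2) < 1)) := by
  have hϖ0 : ϖ ≠ 0 := fun h0 => by rw [h0, map_zero] at hϖ; exact WithZero.coe_ne_zero hϖ.symm
  obtain ⟨u, hu⟩ := exists_latticeGraphIso_root_eq_of_v_two hσ hvσ hϖ h2 w hw (isSelfDualLattice_stdLattice_three_of_v hϖ)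
  subst hu
  have hY : ∀ i j, Valued.v (((((u⁻¹ * γ * u : unitaryGroupOfForm σ ((StdForm.antidiagonal 3).over K)) : GL (Fin 3) K) : Matrix (Fin 3) (Fin 3) K) - 1) i j) ≤ Valued.v ϖ ^ d :=
    fun i j => by rw [← map_pow]; exact (forall_v_conj_sub_one_le_iff_map_sub_one_le_scaleLattice γ u (pow_ne_zero _ hϖ0)).1 hlev i j
  have hY' : ¬ ∀ i j, Valued.v (((((u⁻¹ * γ * u : unitaryGroupOfForm σ ((StdForm.antidiagonal 3).over K)) : GL (Fin 3) K) : Matrix (Fin 3) (Fin 3) K) - 1) i j) ≤ Valued.v ϖ ^ (d + 1) :=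
    fun h => hlev' ((forall_v_conj_sub_one_le_iff_map_sub_one_le_scaleLattice γ u (pow_ne_zero _ hϖ0)).2 fun i j => by rw [map_pow]; exact h i j)
  have hu' : IsUnit ((u : GL (Fin 3) K) : Matrix (Fin 3) (Fin 3) K).det := Matrix.isUnits_det_units _
  have hconj : ((u : GL (Fin 3) K) : Matrix (Fin 3) (Fin 3) K)⁻¹ * (((γ : GL (Fin 3) K) : Matrix (Fin 3) (Fin 3) K) - 1) * ((u : GL (Fin 3) K) : Matrix (Fin 3) (Fin 3) K) =
      (((u⁻¹ * γ * u : unitaryGroupOfForm σ ((StdForm.antidiagonal 3).over K)) : GL (Fin 3) K) : Matrix (Fin 3) (Fin 3) K) - 1 := by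
    rw [coe_inv_mul_mul_sub_one, Matrix.coe_units_inv]
  have hrk' : (latt ((u : GL (Fin 3) K) : Matrix (Fin 3) (Fin 3) K)).map ((Matrix.toLin' ((((γ : GL (Fin 3) K) : Matrix (Fin 3) (Fin 3) K) - 1) ^ 2)).restrictScalars 𝒪[K]) ≤
      scaleLattice (ϖ ^ (2 * d + 1)) (latt ((u : GL (Fin 3) K) : Matrix (Fin 3) (Fin 3) K)) := hrk
  rw [map_toLin'_latt_le_scaleLattice_iff (pow_ne_zero _ hϖ0) _ hu', inv_mul_sq_mul_eq_sq _ hu', hconj] at hrk'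
  have hsq : ∀ i j, Valued.v ((((((u⁻¹ * γ * u : unitaryGroupOfForm σ ((StdForm.antidiagonal 3).over K)) : GL (Fin 3) K) : Matrix (Fin 3) (Fin 3) K) - 1) *
      ((((u⁻¹ * γ * u : unitaryGroupOfForm σ ((StdForm.antidiagonal 3).over K)) : GL (Fin 3) K) : Matrix (Fin 3) (Fin 3) K) - 1)) i j) ≤ Valued.v ϖ ^ (2 * d + 1) :=
    fun i j => by rw [← pow_two, ← map_pow]; exact hrk' i j
  have h1 := class_xor_class_mul_stdLattice_of_rankOne hvσ hσϖ hϖ hres h2 (u⁻¹ * γ * u) hd1 hY hY' hsq c ε hc hεv hε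
  have e1 := exists_mem_mapGL_stdLattice_depthClass_iff u γ ((ϖ ^ d)⁻¹) c
  have e2 := exists_mem_mapGL_stdLattice_depthClass_iff u γ ((ϖ ^ d)⁻¹) (c * ε)
  have hw1 : (latticeGraphIso σ ϖ ((StdForm.antidiagonal 3).over K) u ⟨stdLattice K 3, 0, isSelfDualLattice_stdLattice_three_of_v hϖ⟩).1 =
      mapGL (u : GL (Fin 3) K) (stdLattice K 3) := rfl
  rw [hw1, e1, e2]
  exact h1

end Literature.NumberTheory.Automorphic.UnitaryLatticeTree

end
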